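import Literature.AlgebraicGeometry.Motives.OsculatingLineFamilyRelation
import HarnessLib

/-!
# `3 [S] ≡ a · H^{d-2} + (planes)` for every surface `S` of a cubic hypersurface (Mboro, Thm. 1.2 for `(d, r) = (3, 2)`)

R. Mboro, *Remarks on the `CH₂` of cubic hypersurfaces* (arXiv:1701.04488), Thm. 1.2: for a
smooth hypersurface `X ⊆ ℙⁿ⁺¹` of degree `d` with `Σ_{i=1}^{d-1} iʳ ≤ n`, every `Γ ∈ CH_r(X)` has
`d Γ + P_*(γ) ∈ ℤ · H_X^{n-r}` for some `γ ∈ CH_{r-1}(F(X))` (`P_*` the correspondence of the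
universal line). This file proves the case `(d, r) = (3, 2)` (cubics, surfaces; `1² + 2² = 5 ≤ n`)
at the level of cycles, for an integral cubic hypersurface `X = V₊(F) ⊆ ℙᵈ⁺¹_k` over an
algebraically closed field with `d ≥ 14`, the term `P_*(γ)` — classes swept out by one-parameter
families of lines of `X` — being rendered, in this range, by an integral combination of PLANES of `X`
(`Motives/VerticalSurfacePlanes`: a surface swept by the lines of `X` over a curve is rationally
equivalent to a sum of planes when `d ≥ 14`):

* `ProjFamily.exists_three_smul_primeCycle_sub_mem` — **for every point `z ∈ X` of dimension `2`
  there are `a ∈ ℤ` and a cycle `Pl` supported on plane points with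
  `3 [closure {z}] - a · (V₊(ℓ_c)|_X ⋯ V₊(ℓ₁)|_X · [X]) - Pl ∈ Rat₂(X)`** (`M = V₊(ℓ₁, …, ℓ_c) ⊄ X`
  any `3`-plane whose hyperplanes do not contain `X`);
* `ProjFamily.three_smul_primeCycle_isRationallyEquivalent` — the same as a rational equivalence
  `3 [closure {z}] ∼ a · [X ∩ M] + Σ w_y [closure {y}]` with finitely many plane points `y`;
* `ProjFamily.three_smul_mem_zmultiples_sup_closure_linearSubspaceClasses` — **`3 · CH₂(X) ⊆
  ℤ · (c₁(𝒪_X(1))^{d-2} ∩ [X]) + ⟨plane classes⟩`**, the statement on `CH₂(X)`.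

Proof (the printed one, pp. 6–7). Let `K₀ = κ(z)` (`trdeg_k K₀ = 2`) and `[p₀] ∈ X(K₀)` the
generic point of `S = closure {z}`. By Tsen–Lang, `K₀` is `C₂` for systems
(`isCrSystem_two_of_trdeg_eq_two`), so the conditions "the line `[p₀][r]` osculates `X` to order
`3` at `[p₀]`" — the vanishing at `r` of the coefficients of `s` and `s²` of `F(s p₀ + y)`, forms
of degrees `2` and `1` in `y` (Lemma 1.1: "`f_j(Y) = 0 ∀ j < d`") — together with one coordinate
equation have a solution `r` independent of `p₀` (`2² + 1² + 1² = 6 < d + 2`;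
`exists_osculating_vector`): `F(s p₀ + t r) = t³ F(r)`. Over the integral proper surface
`T = closure (γ, [p₀ ∧ r]) ⊆ X × ℙ^𝐍` (`k(T) ≅ K₀`, `Motives/ProductTrickBase`) the line becomes
the generic line of a family with a Plücker MORPHISM `T → ℙ^𝐍`, and
`Motives/OsculatingLineFamilyRelation` gives `3 · (pr₁₊[closure ι([p₀])])|_X - a · [X ∩ M] - Pl ∈
Rat₂(X)` in both cases of the printed proof (`F(r) ≠ 0`: the line is not on `X`, Case 2;
`F(r) = 0`: the line lies on `X`, Case 1); finally `(pr₁₊[closure ι([p₀])])|_X = [S]`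
(the `γ`-section is birational onto `S`).

Everything is proved; no named facts.

## References

* [Mboro2018] R. Mboro, Remarks on the CH₂ of cubic hypersurfaces, arXiv:1701.04488 = Geom.
  Dedicata (2018), Lemma 1.1 and Thm. 1.2 with its proof (pp. 6–7).
* [Pfister1995] A. Pfister, Quadratic Forms with Applications to Algebraic Geometry and Topology,
  Ch. 5 Cor. 1.5 (Tsen–Lang).
* [Fulton1998] W. Fulton, Intersection Theory, 2nd ed. (1998), Prop. 2.3, Cor. 2.4.1.
-/

noncomputable section

open CategoryTheory CategoryTheory.Limits AlgebraicGeometry MonoidalCategory MvPolynomial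
  TopologicalSpace Order Topology
open Literature.AlgebraicGeometry.Motives.Segre Literature.AlgebraicGeometry.Motives.RatFn

universe u

namespace Literature.AlgebraicGeometry.Motives

attribute [local instance] MvPolynomial.gradedAlgebra MvPolynomial.algebraMvPolynomial
  Literature.AlgebraicGeometry.Motives.ProjBaseChange.algebraBase
  UniversalHyperplaneSection.sectionsAlgebra ProjFamily.functionFieldAlgebra

namespace ProjFamily

open ProjBaseChangeRing ProjectiveSpaceCells ProjectiveSpace FanoScheme ProjSpace
  Literature.RingTheory.MvPolynomial Literature.FieldTheory.QuasiAlgClosed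

/-! ### Osculation from the vanishing of the two coefficient forms (Mboro, Lemma 1.1) -/

section Algebra

variable {K : Type u} [Field K] {N : ℕ}

/-- **Mboro, Lemma 1.1 ("the line `l` is osculating iff `f_j(Y) = 0` for all `j < d`"), `d = 3`:**
if `F(x) = 0` and the coefficients of `s` and `s²` of the cubic `F(s x + y) ∈ K[y][s]` vanish at
`r`, then `F(s x + t r) = t³ F(r)` for all `s, t`. [cite: Mboro2018, Lemma 1.1 (arXiv:1701.04488, p. 6)] -/
theorem eval_add_smul_eq_pow_mul_of_coeff {F : MvPolynomial (Fin (N + 1)) K} (hF : F.IsHomogeneous 3)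
    {x r : Fin (N + 1) → K} (hx : eval x F = 0)
    (h1 : eval r (coeff (Finsupp.single 0 1) (linePoly x F)) = 0)
    (h2 : eval r (coeff (Finsupp.single 0 2) (linePoly x F)) = 0) (s t : K) :
    eval (s • x + t • r) F = t ^ 3 * eval r F := by
  classical
  let P : MvPolynomial (Fin 1) (MvPolynomial (Fin (N + 1)) K) := linePoly x F
  let P' : MvPolynomial (Fin 1) (MvPolynomial (Fin (N + 1)) K) := P - C (coeff 0 P)
  have hcoeff : ∀ α, coeff α P' = if α = 0 then 0 else coeff α P := by
    intro α
    change coeff α (P - C (coeff 0 P)) = _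
    rw [coeff_sub, coeff_C]
    by_cases h : α = 0
    · subst h; simp
    · rw [if_neg (Ne.symm h), if_neg h, sub_zero]
  have hbi : ∀ α, (coeff α P').IsHomogeneous (3 - α.degree) ∧ (3 < α.degree → coeff α P' = 0) := by
    intro α
    rw [hcoeff]
    split_ifs with h
    · exact ⟨isHomogeneous_zero _ _ _, fun _ => rfl⟩
    · exact isBihom_linePoly x hF α
  have hv : ∀ α ∈ P'.support, α.degree < 3 → eval r (coeff α P') = 0 := by
    intro α _ hα
    rw [hcoeff]
    split_ifs with h
    · exact map_zero _
    · obtain ⟨n, rfl⟩ : ∃ n, α = Finsupp.single 0 n := ⟨_, finsupp_fin_one_eq_single α⟩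
      rw [Finsupp.degree_single] at hα
      have hn0 : n ≠ 0 := by rintro rfl; exact h (by rw [Finsupp.single_zero])
      interval_cases n
      · exact absurd rfl hn0
      · exact h1
      · exact h2
  have key := eval_eval_smul_eq_of_isBihom_of_degree hbi hv (fun _ => s) t
  have key' : eval (t • r) (eval (fun _ => C s) P) - eval (t • r) (coeff 0 P) =
      eval (0 : Fin (N + 1) → K) (eval (fun _ => C s) P) - eval (0 : Fin (N + 1) → K) (coeff 0 P) := by
    simpa only [P', map_sub, eval_C] using key
  have e1 : eval (t • r) (eval (fun _ => C s) P) = eval (s • x + t • r) F := eval_eval_linePoly x F s (t • r)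
  have e2 : eval (t • r) (coeff 0 P) = t ^ 3 * eval r F := by
    change eval (t • r) (coeff 0 (linePoly x F)) = _
    rw [eval_coeff_zero_linePoly, eval_smul_of_isHomogeneous hF]
  have e3 : eval (0 : Fin (N + 1) → K) (eval (fun _ => C s) P) = 0 := by
    change eval (0 : Fin (N + 1) → K) (eval (fun _ => C s) (linePoly x F)) = 0
    rw [eval_eval_linePoly, add_zero, eval_smul_of_isHomogeneous hF, hx, mul_zero]
  have e4 : eval (0 : Fin (N + 1) → K) (coeff 0 P) = 0 := by
    change eval (0 : Fin (N + 1) → K) (coeff 0 (linePoly x F)) = 0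
    rw [eval_coeff_zero_linePoly, show (0 : Fin (N + 1) → K) = (0 : K) • r from (zero_smul K r).symm,
      eval_smul_of_isHomogeneous hF, zero_pow three_ne_zero, zero_mul]
  rw [e1, e2, e3, e4, sub_self, sub_eq_zero] at key'
  exact key'

/-- **An osculating direction exists over a `C₂` field** (Mboro, proof of Thm. 1.2: "by
Tsen–Lang … the restriction `π_Σ : Q|_Σ → Σ` admits a rational section", for `(d, r) = (3, 2)`):
for a cubic form `F` in `N + 1 ≥ 7` variables over a field `K` which is `C₂` for systems and a
zero `x ≠ 0` of `F`, there is `r` independent of `x` with `F(s x + t r) = t³ F(r)` for all `s, t`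
(a common zero of the two coefficient forms, of degrees `2, 1`, and of a coordinate `X_{j₀}` with
`x_{j₀} ≠ 0`: `2² + 1² + 1² = 6 < N + 1`). [cite: Mboro2018, proof of Thm. 1.2 (arXiv:1701.04488, p. 6)] [cite: Pfister1995, Ch. 5 Def. 1.1 and Cor. 1.5] -/
theorem exists_osculating_vector (hK : IsCrSystem 2 K) (hN : 6 ≤ N) {F : MvPolynomial (Fin (N + 1)) K}
    (hF : F.IsHomogeneous 3) {x : Fin (N + 1) → K} (hx0 : x ≠ 0) (hx : eval x F = 0) :
    ∃ r : Fin (N + 1) → K, LinearIndependent K ![x, r] ∧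
      ∀ s t : K, eval (s • x + t • r) F = t ^ 3 * eval r F := by
  classical
  obtain ⟨j₀, hj₀⟩ := Function.ne_iff.mp hx0
  let g : Fin 3 → MvPolynomial (Fin (N + 1)) K :=
    ![coeff (Finsupp.single 0 1) (linePoly x F), coeff (Finsupp.single 0 2) (linePoly x F), X j₀]
  let e : Fin 3 → ℕ := ![2, 1, 1]
  have he : ∀ j, 0 < e j := by
    intro j; fin_cases j <;> simp [e]
  have hg : ∀ j, (g j).IsHomogeneous (e j) := by
    intro j
    fin_cases j
    · have h := (isBihom_linePoly x hF (Finsupp.single 0 1)).1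
      rw [Finsupp.degree_single] at h
      exact h
    · have h := (isBihom_linePoly x hF (Finsupp.single 0 2)).1
      rw [Finsupp.degree_single] at h
      exact h
    · exact isHomogeneous_X K j₀
  have hcount : ∑ j, e j ^ 2 < Fintype.card (Fin (N + 1)) := by
    rw [Fintype.card_fin, Fin.sum_univ_three]
    simp only [e, Matrix.cons_val_zero, Matrix.cons_val_one, Matrix.cons_val]
    omega
  obtain ⟨r, hr0, hr⟩ := hK.exists_common_zero g e he hg hcount
  have h3 : r j₀ = 0 := by
    have h := hr 2
    change eval r (X j₀) = 0 at h
    rwa [eval_X] at h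
  refine ⟨r, ?_, fun s t => eval_add_smul_eq_pow_mul_of_coeff hF hx (hr 0) (hr 1) s t⟩
  refine LinearIndependent.pair_iff.2 fun s t hst => ?_
  have hj := congr_fun hst j₀
  simp only [Pi.add_apply, Pi.smul_apply, smul_eq_mul, Pi.zero_apply, h3, mul_zero, add_zero] at hj
  have hs : s = 0 := (mul_eq_zero.1 hj).resolve_right hj₀
  refine ⟨hs, ?_⟩
  rw [hs, zero_smul, zero_add] at hst
  exact (smul_eq_zero.1 hst).resolve_right hr0

end Algebra

/-! ### The relation `3 [S] - a · [X ∩ M] - (planes) ∈ Rat₂(X)` -/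

section Main

variable {k : Type u} [Field k] [IsAlgClosed k] {d : ℕ} (X : SchemeOver k) [IsIntegral X.left]
  [LocallyOfFiniteType X.hom] (i : X ⟶ projectiveSpace (d + 1) k) [IsClosedImmersion i.left]
  {F : MvPolynomial (Fin (d + 1 + 1)) k}

/-- **Mboro, Thm. 1.2 for cubic hypersurfaces and surfaces (`d = 3`, `r = 2`), at the level of
cycles.** Let `X = V₊(F) ⊆ ℙᵈ⁺¹_k` be an integral cubic hypersurface over an algebraically closed
field, `d ≥ 14`, and `M = V₊(ℓ₁, …, ℓ_c) ⊄ X` a `3`-plane (`2 + c = d`) whose hyperplanes do not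
contain `X`. For every point `z ∈ X` of dimension `2` (an integral surface `S = closure {z}`) there
are `a ∈ ℤ` and a cycle `Pl` on `X` supported on plane points with
`3 [S] - a · (V₊(ℓ_c)|_X ⋯ V₊(ℓ₁)|_X · [X]) - Pl ∈ Rat₂(X)` — "`d Γ + P_*(γ) ∈ ℤ · H_X^{n-r}`", with
`P_*(γ)` an integral combination of planes in this range (module docstring). Core statement: the
surface is given by a preimmersed `K₀`-point `a₀ = [p₀]` of `X` with underlying point `z`
(`trdeg_k K₀ = 2`), together with an osculating direction `r₀` (`F(s p₀ + t r₀) = t³ F(r₀)`).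
[cite: Mboro2018, Thm. 1.2 and its proof (arXiv:1701.04488, pp. 6–7)] -/
theorem exists_three_smul_primeCycle_sub_mem_of_osculating (hd : 14 ≤ d)
    (hF : F ∈ grading (Fin (d + 1 + 1)) k 3) (hprime : Prime F)
    (hrange : Set.range i.left.base =
      ProjectiveSpectrum.zeroLocus (homogeneousSubmodule (Fin (d + 1 + 1)) k) {F})
    {c : ℕ} (hdim : 2 + c = d) (ℓ : Fin c → MvPolynomial (Fin (d + 1 + 1)) k)
    (hℓ : ∀ j, ℓ j ∈ grading (Fin (d + 1 + 1)) k 1) (hlin : LinearIndependent k ℓ)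
    (hav : ∀ j, (formDivisor (ℓ j) (hℓ j) (hlin.ne_zero j)).Avoids (i.left.base (genericPoint ↥X.left)))
    (w : ↥(projectiveSpace (d + 1) k).left)
    (hw : (ProjectiveSpectrum.asHomogeneousIdeal
      (𝒜 := homogeneousSubmodule (Fin (d + 1 + 1)) k) w).toIdeal = Ideal.span (Set.range ℓ))
    (hFw : F ∉ ProjectiveSpectrum.asHomogeneousIdeal (𝒜 := homogeneousSubmodule (Fin (d + 1 + 1)) k) w)
    {K₀ : Type u} [Field K₀] [Algebra k K₀] (htr : Algebra.trdeg k K₀ = 2)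
    (a₀ : AlgPoints X K₀) [IsPreimmersion a₀.left] {z : ↥X.left} (ha₀z : a₀.pt = z)
    (p₀ r₀ : Fin (d + 1 + 1) → K₀) (hpr : LinearIndependent K₀ ![p₀, r₀]) (hp₀0 : p₀ ≠ 0)
    (hPp : AlgPoints.map i a₀ = pointOfVec k p₀ hp₀0)
    (hosc₀ : ∀ s t : K₀, eval (s • p₀ + t • r₀) (MvPolynomial.map (algebraMap k K₀) F) =
      t ^ 3 * eval r₀ (MvPolynomial.map (algebraMap k K₀) F)) :
    ∃ (a : ℤ) (Pl : AlgebraicCycle X.left ℤ), (∀ y, Pl y ≠ 0 → IsLinearSubspacePoint 2 (d + 1) i y) ∧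
      3 • primeCycle z - a • CartierDivisor.iterInter c
          (fun j => (formDivisor (ℓ j) (hℓ j) (hlin.ne_zero j)).pullbackAvoiding i.left (hav j))
          (primeCycle (genericPoint ↥X.left)) - Pl ∈ ratTrivial X.left 2 := by
  classical
  haveI : IsProper (projectiveSpace (d + 1) k).hom := isProper_projectiveSpace (d + 1) k
  haveI : IsProper X.hom := by rw [← Over.w i]; infer_instance
  have hF0 : F ≠ 0 := hprime.ne_zero
  have hF3 : F.IsHomogeneous 3 := (mem_homogeneousSubmodule 3 F).1 hF
  have hr₀0 : r₀ ≠ 0 := by simpa using hpr.ne_zero 1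
  -- the Plücker space and the Plücker vector of the line `[p₀][r₀]`
  let NN : ℕ := (d + 1) * (d + 1) + 2 * (d + 1)
  let PN : SchemeOver k := projectiveSpace NN k
  haveI : IsProper PN.hom := isProper_projectiveSpace NN k
  let w₁ : Fin (NN + 1) → K₀ :=
    fun c => wedge p₀ r₀ ((plIdx (d + 1)).symm c).1 ((plIdx (d + 1)).symm c).2
  have hw₁ : w₁ ≠ 0 := by
    intro h0
    apply (wedge_ne_zero_iff p₀ r₀).2 hpr
    funext a b
    have := congr_fun h0 (plIdx (d + 1) (a, b))
    simpa [w₁] using this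
  -- the ambient `Y = X × ℙ^𝐍` and the `K₀`-point `Q = (a₀, [w₁])`
  let Y : SchemeOver k := X ⊗ PN
  let Q : AlgPoints Y (K₀) := AlgPoints.prodEquiv.symm (a₀, pointOfVec k w₁ hw₁)
  let prX : Y ⟶ X := CartesianMonoidalCategory.fst _ _
  let pr₁ : Y ⟶ PN := CartesianMonoidalCategory.snd _ _
  have hQX : Q ≫ prX = a₀ := by
    change CartesianMonoidalCategory.lift a₀ (pointOfVec k w₁ hw₁) ≫ CartesianMonoidalCategory.fst _ _ = a₀
    rw [CartesianMonoidalCategory.lift_fst]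
  have hQ₁ : Q ≫ pr₁ = pointOfVec k w₁ hw₁ := by
    change CartesianMonoidalCategory.lift a₀ (pointOfVec k w₁ hw₁) ≫ CartesianMonoidalCategory.snd _ _ = _
    rw [CartesianMonoidalCategory.lift_snd]
  -- `𝒪_{Y,Q} → K₀` is onto (through `a₀`, a preimmersion)
  have surj_of_pre : ∀ {Z : Scheme.{u}} (g : Spec (CommRingCat.of (K₀)) ⟶ Z)
      [IsPreimmersion g], Function.Surjective (Scheme.stalkClosedPointTo g) := by
    intro Z g _
    change Function.Surjective (g.stalkMap _ ≫ (stalkClosedPointIso (CommRingCat.of (K₀))).hom)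
    intro y
    obtain ⟨x, hx⟩ := g.stalkMap_surjective _
      ((stalkClosedPointIso (CommRingCat.of (K₀))).inv y)
    refine ⟨x, ?_⟩
    change (stalkClosedPointIso (CommRingCat.of (K₀))).hom (g.stalkMap _ x) = y
    rw [hx, ← CategoryTheory.comp_apply, Iso.inv_hom_id]; rfl
  have hQX' : Q.left ≫ prX.left = a₀.left := congrArg CommaMorphism.left hQX
  haveI hpreQ : IsPreimmersion (Q.left ≫ prX.left) := hQX'.symm ▸ (inferInstance : IsPreimmersion a₀.left)
  have hQ : Function.Surjective (Scheme.stalkClosedPointTo Q.left) := by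
    have h : Scheme.stalkClosedPointTo (Q.left ≫ prX.left) =
        prX.left.stalkMap _ ≫ Scheme.stalkClosedPointTo Q.left := Scheme.stalkClosedPointTo_comp _ _
    have hs : Function.Surjective (Scheme.stalkClosedPointTo (Q.left ≫ prX.left)) :=
      @surj_of_pre _ (Q.left ≫ prX.left) hpreQ
    rw [h] at hs
    exact Function.Surjective.of_comp hs
  -- the base `T`
  obtain ⟨τ, e, hτ1, hτk, hτη, hgen, hek⟩ := exists_ringEquiv_functionField_of_surjective Y Q hQ
  let T : SchemeOver k := Over.mk ((ClosedSubvariety.ofPoint Y.left Q.pt).ι ≫ Y.hom)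
  haveI : IsIntegral T.left := inferInstanceAs (IsIntegral (ClosedSubvariety.ofPoint Y.left Q.pt).carrier)
  haveI : IsProper T.hom := isProper_ofPoint Y Q
  have hT2 : height (genericPoint T.left) = 2 := by
    have h := height_genericPoint_ofPoint_eq_toENat_trdeg Y Q hQ
    rw [htr] at h
    exact h.trans (by simp)
  let Tι : T ⟶ Y := Over.homMk (ClosedSubvariety.ofPoint Y.left Q.pt).ι rfl
  let f₁ : T ⟶ PN := Tι ≫ pr₁
  obtain ⟨h0₁, hP₁⟩ := qgen_comp_eq_pointOfVec Y Q hτ1 hgen hek pr₁ hw₁ hQ₁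
  -- the coefficient field `K = k(T) ≅ K₀`
  let φ : K₀ →+* T.left.functionField := e.symm.toRingHom
  have hφ : ∀ c : k, φ (algebraMap k _ c) = algebraMap k T.left.functionField c := fun c => by
    change e.symm (algebraMap k _ c) = _
    rw [← hek c, RingEquiv.symm_apply_apply]
  let φa : K₀ →ₐ[k] T.left.functionField := { φ with commutes' := hφ }
  letI algφ : Algebra (K₀) T.left.functionField := φ.toAlgebra
  let x : Fin (d + 1 + 1) → T.left.functionField := ⇑φa ∘ p₀
  let y : Fin (d + 1 + 1) → T.left.functionField := ⇑φa ∘ r₀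
  have hmat : (![x, y] : Fin 2 → Fin (d + 1 + 1) → T.left.functionField) = fun a => ⇑φa ∘ ![p₀, r₀] a := by
    ext a j; fin_cases a <;> rfl
  have hxy : LinearIndependent T.left.functionField ![x, y] := by
    rw [hmat]
    exact (linearIndependent_algebraMap_comp_iff (R := K₀)
      (S := T.left.functionField) (v := ![p₀, r₀])).2 hpr
  have hx0 : x ≠ 0 := by simpa using hxy.ne_zero 0
  -- the osculating identity over `k(T)`
  have hevalT : ∀ u : Fin (d + 1 + 1) → K₀,
      eval (⇑φa ∘ u) (MvPolynomial.map (algebraMap k T.left.functionField) F) =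
        φ (eval u (MvPolynomial.map (algebraMap k (K₀)) F)) :=
    fun u => eval_comp_map_eq φ hφ u F
  have hfun : ∀ s' t' : K₀,
      (e.symm s' • x + e.symm t' • y : Fin (d + 1 + 1) → T.left.functionField) =
        ⇑φa ∘ (s' • p₀ + t' • r₀) := by
    intro s' t'
    funext j
    simp only [x, y, Pi.add_apply, Pi.smul_apply, smul_eq_mul, map_add, map_mul, Function.comp_apply]
    rfl
  have hoscT : ∀ s t : T.left.functionField,
      eval (s • x + t • y) (MvPolynomial.map (algebraMap k T.left.functionField) F) =
        t ^ 3 * eval y (MvPolynomial.map (algebraMap k T.left.functionField) F) := by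
    intro s t
    obtain ⟨s', rfl⟩ := e.symm.surjective s
    obtain ⟨t', rfl⟩ := e.symm.surjective t
    rw [hfun, hevalT, hosc₀ s' t', map_mul, map_pow, hevalT]
    rfl
  -- Plücker data of the line map
  have hPw : ∀ a b : Fin (d + 1 + 1), (fun j => e.symm (w₁ j)) (plIdx (d + 1) (a, b)) = wedge x y a b := by
    intro a b
    simp only [w₁, Equiv.symm_apply_apply]
    exact (congr_fun (congr_fun (wedge_map φ p₀ r₀) a) b).symm
  -- the relation over `T`, in both cases of the printed proof
  have hrel : ∃ (a : ℤ) (Pl : AlgebraicCycle X.left ℤ),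
      (∀ y', Pl y' ≠ 0 → IsLinearSubspacePoint 2 (d + 1) i y') ∧
      3 • restrictMapFst T X i (primeCycle (genericFibreι (d + 1) T
          (pointOfVec T.left.functionField x hx0).pt)) -
        a • CartierDivisor.iterInter c
          (fun j => (formDivisor (ℓ j) (hℓ j) (hlin.ne_zero j)).pullbackAvoiding i.left (hav j))
          (primeCycle (genericPoint ↥X.left)) - Pl ∈ ratTrivial X.left 2 := by
    by_cases hFr : eval r₀ (MvPolynomial.map (algebraMap k (K₀)) F) = 0
    · -- Case 1: the line lies on `X`
      have hFlineT : ∀ s t : T.left.functionField,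
          eval (s • x + t • y) (MvPolynomial.map (algebraMap k T.left.functionField) F) = 0 := by
        intro s t
        rw [hoscT, show y = ⇑φa ∘ r₀ from rfl, hevalT, hFr, map_zero, mul_zero]
      exact exists_relation_of_line_in_X_over_T T X i hd hF hprime hrange hT2 hdim ℓ hℓ hlin hav w hw hFw
        f₁ x y hxy hFlineT _ hPw h0₁ hP₁
    · -- Case 2: the line is not on `X`
      have hFyT : eval y (MvPolynomial.map (algebraMap k T.left.functionField) F) ≠ 0 := by
        rw [show y = ⇑φa ∘ r₀ from rfl, hevalT]
        exact (map_ne_zero_iff φ φ.injective).2 hFr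
      exact exists_relation_of_osculating_line_over_T T X i hd hF hprime hrange hT2 hdim ℓ hℓ hlin hav w hw
        hFw f₁ x y hxy hoscT hFyT _ hPw h0₁ hP₁
  obtain ⟨a, Pl, hPl, hrelT⟩ := hrel
  -- identification of the `γ`-section: `(pr₁₊[closure ι([x])])|_X = [S]`
  have hinjK : Function.Injective (iK (d + 1) T X i).base := (iK (d + 1) T X i).isClosedEmbedding.injective
  have hcomp : CommRingCat.ofHom e.toRingHom ≫ CommRingCat.ofHom e.symm.toRingHom = 𝟙 _ := by
    ext b; exact e.symm_apply_apply b
  have h1 : Spec.map (CommRingCat.ofHom e.symm.toRingHom) ≫ Spec.map (CommRingCat.ofHom e.toRingHom) = 𝟙 _ := by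
    rw [← Spec.map_comp, hcomp, Spec.map_id]
  have hqgen : Spec.map (CommRingCat.ofHom φ) ≫ τ = qgen T := by
    rw [← hgen]
    exact (reassoc_of% h1) _
  have hcomp' : CommRingCat.ofHom φ ≫ CommRingCat.ofHom e.toRingHom = 𝟙 _ := by
    ext b; exact e.apply_symm_apply b
  have h2 : Spec.map (CommRingCat.ofHom e.toRingHom) ≫ Spec.map (CommRingCat.ofHom φ) = 𝟙 _ := by
    rw [← Spec.map_comp, hcomp', Spec.map_id]
  haveI : IsIso (Spec.map (CommRingCat.ofHom φ)) := ⟨⟨Spec.map (CommRingCat.ofHom e.toRingHom), h1, h2⟩⟩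
  haveI hpreφ : IsPreimmersion (Spec.map (CommRingCat.ofHom φ)) := inferInstance
  -- LINK: a `K`-point `a'` of `X` with `a' ≫ i = Spec φ ≫ [u]` lies under `[φ ∘ u] ∈ ℙ_K(K)`
  have link : ∀ (a' : Spec T.left.functionField ⟶ X.left) (ha' : a' ≫ X.hom = qgen T ≫ T.hom)
      (u : Fin (d + 1 + 1) → K₀) (hu0 : u ≠ 0),
      a' ≫ i.left = Spec.map (CommRingCat.ofHom φa.toRingHom) ≫ (pointOfVec k u hu0).left →
      (pointOfVec T.left.functionField (⇑φa ∘ u) (ProjectiveSpace.comp_ne_zero φa hu0)).pt =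
        uPt (d + 1) T X i a' ha' := by
    intro a' ha' u hu0 hai
    suffices hmor : (pointOfVec T.left.functionField (⇑φa ∘ u) (ProjectiveSpace.comp_ne_zero φa hu0)).left =
        sPt (d + 1) T X i a' ha' by
      change (pointOfVec T.left.functionField (⇑φa ∘ u) (ProjectiveSpace.comp_ne_zero φa hu0)).left.base
        (IsLocalRing.closedPoint _) = (sPt (d + 1) T X i a' ha').base (IsLocalRing.closedPoint _)
      rw [hmor]
      rfl
    have hsPt : sPt (d + 1) T X i a' ha' ≫ Proj.map (mapGraded k T.left.functionField (Fin (d + 1 + 1)))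
        (irrelevant_le_map k T.left.functionField (Fin (d + 1 + 1))) = a' ≫ i.left := by
      have e1 : iK (d + 1) T X i ≫ genericFibreι (d + 1) T ≫
          (CartesianMonoidalCategory.fst (projectiveSpace (d + 1) k) T).left =
            ιX T X ≫ (CartesianMonoidalCategory.fst X T).left ≫ i.left := by
        rw [← Category.assoc, iK_genericFibreι, Category.assoc, whiskerRight_left_fst]
      change (tPt T X a' ha' ≫ iK (d + 1) T X i) ≫ _ = _
      refine (congrArg ((tPt T X a' ha' ≫ iK (d + 1) T X i) ≫ ·) (genericFibreι_fst (d + 1) T).symm).trans ?_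
      refine (Category.assoc _ _ _).trans ?_
      refine (congrArg (tPt T X a' ha' ≫ ·) e1).trans ?_
      refine (Category.assoc _ _ _).symm.trans ?_
      refine (congrArg (· ≫ ((CartesianMonoidalCategory.fst X T).left ≫ i.left)) (tPt_ιX T X a' ha')).trans ?_
      refine (Category.assoc _ _ _).symm.trans ?_
      exact congrArg (· ≫ i.left) (liftPt_fst T X a' ha')
    refine (isPullback_projMap' k T.left.functionField (n := d + 1)).hom_ext ?_ ?_
    · exact ((pointOfVec_left_comp_projMap (k := k) (⇑φa ∘ u) (ProjectiveSpace.comp_ne_zero φa hu0)).trans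
        ((pointOfVec_left_comp_algHom φa u hu0).trans (hai.symm.trans hsPt.symm)))
    · have hs1 : (pointOfVec T.left.functionField (⇑φa ∘ u) (ProjectiveSpace.comp_ne_zero φa hu0)).left ≫
          projToSpec (Fin (d + 1 + 1)) T.left.functionField = 𝟙 _ := by
        have hw' := Over.w (pointOfVec T.left.functionField (⇑φa ∘ u) (ProjectiveSpace.comp_ne_zero φa hu0))
        change (pointOfVec T.left.functionField (⇑φa ∘ u) (ProjectiveSpace.comp_ne_zero φa hu0)).left ≫
          projToSpec (Fin (d + 1 + 1)) T.left.functionField =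
            Spec.map (CommRingCat.ofHom (RingHom.id T.left.functionField)) at hw'
        rw [hw']
        exact Spec.map_id _
      exact hs1.trans (sPt_projToSpec (d + 1) T X i a' ha').symm
  -- the `γ`-point
  let aT : Spec T.left.functionField ⟶ X.left := qgen T ≫ (ClosedSubvariety.ofPoint Y.left Q.pt).ι ≫ prX.left
  have haT_ha : aT ≫ X.hom = qgen T ≫ T.hom := by
    change (qgen T ≫ (ClosedSubvariety.ofPoint Y.left Q.pt).ι ≫ prX.left) ≫ X.hom =
      qgen T ≫ ((ClosedSubvariety.ofPoint Y.left Q.pt).ι ≫ Y.hom)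
    simp only [Category.assoc, Over.w prX]
  have hτι : τ ≫ (ClosedSubvariety.ofPoint Y.left Q.pt).ι ≫ prX.left = a₀.left := by
    rw [← Category.assoc, hτ1]; exact hQX'
  have haT : aT = Spec.map (CommRingCat.ofHom φ) ≫ a₀.left := by
    change qgen T ≫ (ClosedSubvariety.ofPoint Y.left Q.pt).ι ≫ prX.left = _
    exact ((congrArg (· ≫ ((ClosedSubvariety.ofPoint Y.left Q.pt).ι ≫ prX.left)) hqgen.symm).trans
      ((Category.assoc _ _ _).trans (congrArg (Spec.map (CommRingCat.ofHom φ) ≫ ·) hτι)))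
  have haTi : aT ≫ i.left = Spec.map (CommRingCat.ofHom φa.toRingHom) ≫ (pointOfVec k p₀ hp₀0).left := by
    rw [haT, Category.assoc]
    exact congrArg (Spec.map (CommRingCat.ofHom φ) ≫ ·) (congrArg CommaMorphism.left hPp)
  have hptp : (pointOfVec T.left.functionField x hx0).pt = uPt (d + 1) T X i aT haT_ha :=
    link aT haT_ha p₀ hp₀0 haTi
  haveI : @IsPreimmersion (Spec (CommRingCat.of (K₀))) X.left a₀.left :=
    ‹IsPreimmersion a₀.left›
  haveI hpreaT : IsPreimmersion aT := by rw [haT]; exact IsPreimmersion.comp _ _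
  have haTpt : aT.base (IsLocalRing.closedPoint _) = z := by
    rw [haT, ← ha₀z]
    change a₀.left.base ((Spec.map (CommRingCat.ofHom φ)).base (IsLocalRing.closedPoint _)) =
      a₀.left.base (IsLocalRing.closedPoint (K₀))
    congr 1
    exact Subsingleton.elim (α := PrimeSpectrum (K₀)) _ _
  -- the `γ`-section pushes forward to `[S]`
  have hMa : AlgebraicCycle.map (CartesianMonoidalCategory.fst X T).left height height
      (primeCycle ((ιX T X).base (uXPt T X aT haT_ha))) = primeCycle z := by
    have hliftpt : (ιX T X).base (uXPt T X aT haT_ha) =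
        (liftPt T X aT haT_ha).base (IsLocalRing.closedPoint _) := by
      change ((tPt T X aT haT_ha ≫ ιX T X).base _) = _
      rw [tPt_ιX]
    rw [hliftpt]
    haveI : LocallyOfFiniteType ((CartesianMonoidalCategory.fst X T).left ≫ X.hom) :=
      inferInstanceAs (LocallyOfFiniteType (X ⊗ T).hom)
    rw [algebraicCycleMap_primeCycle_of_residueFieldMap_surjective
      (CartesianMonoidalCategory.fst X T).left X.hom ((liftPt T X aT haT_ha).base _) ?_]
    · rw [← haTpt]
      congr 1
      change ((liftPt T X aT haT_ha ≫ (CartesianMonoidalCategory.fst X T).left).base _) = _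
      rw [liftPt_fst]
    · refine residueFieldMap_surjective_of_comp (liftPt T X aT haT_ha) _ _ ?_
      have key : ∀ g : Spec T.left.functionField ⟶ X.left, g = aT →
          Function.Surjective (g.residueFieldMap (IsLocalRing.closedPoint _)) := by
        rintro g rfl; exact residueFieldMap_surjective_of_isPreimmersion _ _
      exact key _ (liftPt_fst T X aT haT_ha)
  have hR : restrictMapFst T X i (primeCycle (genericFibreι (d + 1) T
      (pointOfVec T.left.functionField x hx0).pt)) = primeCycle z := by
    have hjι : (i ▷ T).left.base ((ιX T X).base (uXPt T X aT haT_ha)) =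
        genericFibreι (d + 1) T ((iK (d + 1) T X i).base (uXPt T X aT haT_ha)) := by
      change ((ιX T X ≫ (i ▷ T).left).base _) = ((iK (d + 1) T X i ≫ genericFibreι (d + 1) T).base _)
      rw [iK_genericFibreι]
    rw [hptp, ← iK_uXPt, ← hjι, restrictMapFst_primeCycle_whiskerRight, hMa]
  refine ⟨a, Pl, hPl, ?_⟩
  rw [← hR]
  exact hrelT

/-- **Mboro, Thm. 1.2 for cubic hypersurfaces and surfaces (`d = 3`, `r = 2`), at the level of
cycles.** Let `X = V₊(F) ⊆ ℙᵈ⁺¹_k` be an integral cubic hypersurface over an algebraically closed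
field, `d ≥ 14`, and `M = V₊(ℓ₁, …, ℓ_c) ⊄ X` a `3`-plane (`2 + c = d`) whose hyperplanes do not
contain `X`. For every point `z ∈ X` of dimension `2` (an integral surface `S = closure {z}`) there
are `a ∈ ℤ` and a cycle `Pl` on `X` supported on plane points with
`3 [S] - a · (V₊(ℓ_c)|_X ⋯ V₊(ℓ₁)|_X · [X]) - Pl ∈ Rat₂(X)` — "`d Γ + P_*(γ) ∈ ℤ · H_X^{n-r}`", with
`P_*(γ)` an integral combination of planes in this range (Tsen–Lang gives the osculating direction
over `κ(z)`, `exists_osculating_vector`; then `exists_three_smul_primeCycle_sub_mem_of_osculating`).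
[cite: Mboro2018, Thm. 1.2 and its proof (arXiv:1701.04488, pp. 6–7)] [cite: Pfister1995, Ch. 5 Cor. 1.5] -/
theorem exists_three_smul_primeCycle_sub_mem (hd : 14 ≤ d)
    (hF : F ∈ grading (Fin (d + 1 + 1)) k 3) (hprime : Prime F)
    (hrange : Set.range i.left.base =
      ProjectiveSpectrum.zeroLocus (homogeneousSubmodule (Fin (d + 1 + 1)) k) {F})
    {c : ℕ} (hdim : 2 + c = d) (ℓ : Fin c → MvPolynomial (Fin (d + 1 + 1)) k)
    (hℓ : ∀ j, ℓ j ∈ grading (Fin (d + 1 + 1)) k 1) (hlin : LinearIndependent k ℓ)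
    (hav : ∀ j, (formDivisor (ℓ j) (hℓ j) (hlin.ne_zero j)).Avoids (i.left.base (genericPoint ↥X.left)))
    (w : ↥(projectiveSpace (d + 1) k).left)
    (hw : (ProjectiveSpectrum.asHomogeneousIdeal
      (𝒜 := homogeneousSubmodule (Fin (d + 1 + 1)) k) w).toIdeal = Ideal.span (Set.range ℓ))
    (hFw : F ∉ ProjectiveSpectrum.asHomogeneousIdeal (𝒜 := homogeneousSubmodule (Fin (d + 1 + 1)) k) w)
    (z : ↥X.left) (hz : height z = 2) :
    ∃ (a : ℤ) (Pl : AlgebraicCycle X.left ℤ), (∀ y, Pl y ≠ 0 → IsLinearSubspacePoint 2 (d + 1) i y) ∧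
      3 • primeCycle z - a • CartierDivisor.iterInter c
          (fun j => (formDivisor (ℓ j) (hℓ j) (hlin.ne_zero j)).pullbackAvoiding i.left (hav j))
          (primeCycle (genericPoint ↥X.left)) - Pl ∈ ratTrivial X.left 2 := by
  classical
  haveI : IsProper (projectiveSpace (d + 1) k).hom := isProper_projectiveSpace (d + 1) k
  haveI : IsProper X.hom := by rw [← Over.w i]; infer_instance
  have hF3 : F.IsHomogeneous 3 := (mem_homogeneousSubmodule 3 F).1 hF
  -- the generic point of `S = closure {z}` as a `K₀`-point, `K₀ = κ(z)`
  letI algK : Algebra k (X.left.residueField z) :=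
    ((Scheme.ΓSpecIso (CommRingCat.of k)).inv ≫ X.hom.appTop ≫ X.left.Γevaluation z).hom.toAlgebra
  have halg : Spec.map (CommRingCat.ofHom (algebraMap k (X.left.residueField z))) =
      X.left.fromSpecResidueField z ≫ X.hom :=
    Scheme.SpecMap_ΓSpecIso_inv_appTop_Γevaluation X.hom z
  let a₀ : AlgPoints X (X.left.residueField z) := AlgPoints.mk (X.left.fromSpecResidueField z) halg.symm
  haveI : IsPreimmersion a₀.left := inferInstanceAs (IsPreimmersion (X.left.fromSpecResidueField z))
  have ha₀z : a₀.pt = z := Scheme.fromSpecResidueField_apply z _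
  -- `trdeg_k κ(z) = 2`, so `κ(z)` is `C₂` for systems
  have htr : Algebra.trdeg k (X.left.residueField z) = 2 := by
    have h := Scheme.height_eq_toENat_trdeg_residueField X.hom z halg
    rw [hz] at h
    exact_mod_cast (Cardinal.toENat_eq_ofNat.mp h.symm)
  have hK : IsCrSystem 2 (X.left.residueField z) := isCrSystem_two_of_trdeg_eq_two htr
  -- homogeneous coordinates `p₀` of the generic point; `F(p₀) = 0`
  obtain ⟨p₀, hp₀0, hPp⟩ := exists_eq_pointOfVec (AlgPoints.map i a₀)
  have hFp : eval p₀ (MvPolynomial.map (algebraMap k (X.left.residueField z)) F) = 0 := by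
    have hmem : (pointOfVec k p₀ hp₀0).pt ∈ Set.range i.left.base := by
      rw [← hPp]; exact ⟨a₀.pt, rfl⟩
    rw [hrange] at hmem
    have h3 := (pt_pointOfVec_mem_zeroLocus_iff p₀ hp₀0 (by norm_num : 0 < 3)
      ((mem_homogeneousSubmodule 3 F).mpr hF3)).1 hmem
    rw [MvPolynomial.eval_map]
    exact h3
  -- Tsen–Lang: an osculating direction `r₀`
  obtain ⟨r₀, hpr, hosc₀⟩ := exists_osculating_vector hK (N := d + 1) (by omega) (hF3.map _) hp₀0 hFp
  exact exists_three_smul_primeCycle_sub_mem_of_osculating X i hd hF hprime hrange hdim ℓ hℓ hlin hav w hw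
    hFw htr a₀ ha₀z p₀ r₀ hpr hp₀0 hPp hosc₀

/-- **`3 [S] ∼ a · [X ∩ M] + Σ_y w_y [Π_y]` on the cubic hypersurface `X` (`d ≥ 14`), with
finitely many planes `Π_y = closure {y} ⊆ X`** — `exists_three_smul_primeCycle_sub_mem` as a
rational equivalence with an explicit finite plane sum. [cite: Mboro2018, Thm. 1.2 (arXiv:1701.04488, p. 6)] -/
theorem three_smul_primeCycle_isRationallyEquivalent (hd : 14 ≤ d)
    (hF : F ∈ grading (Fin (d + 1 + 1)) k 3) (hprime : Prime F)
    (hrange : Set.range i.left.base =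
      ProjectiveSpectrum.zeroLocus (homogeneousSubmodule (Fin (d + 1 + 1)) k) {F})
    {c : ℕ} (hdim : 2 + c = d) (ℓ : Fin c → MvPolynomial (Fin (d + 1 + 1)) k)
    (hℓ : ∀ j, ℓ j ∈ grading (Fin (d + 1 + 1)) k 1) (hlin : LinearIndependent k ℓ)
    (hav : ∀ j, (formDivisor (ℓ j) (hℓ j) (hlin.ne_zero j)).Avoids (i.left.base (genericPoint ↥X.left)))
    (w : ↥(projectiveSpace (d + 1) k).left)
    (hw : (ProjectiveSpectrum.asHomogeneousIdeal
      (𝒜 := homogeneousSubmodule (Fin (d + 1 + 1)) k) w).toIdeal = Ideal.span (Set.range ℓ))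
    (hFw : F ∉ ProjectiveSpectrum.asHomogeneousIdeal (𝒜 := homogeneousSubmodule (Fin (d + 1 + 1)) k) w)
    (z : ↥X.left) (hz : height z = 2) :
    ∃ (a : ℤ) (s : Finset ↥X.left) (wt : ↥X.left → ℤ), (∀ y ∈ s, IsLinearSubspacePoint 2 (d + 1) i y) ∧
      IsRationallyEquivalent (3 • primeCycle z)
        (a • CartierDivisor.iterInter c
          (fun j => (formDivisor (ℓ j) (hℓ j) (hlin.ne_zero j)).pullbackAvoiding i.left (hav j))
          (primeCycle (genericPoint ↥X.left)) + ∑ y ∈ s, wt y • primeCycle y) 2 := by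
  classical
  haveI : IsProper (projectiveSpace (d + 1) k).hom := isProper_projectiveSpace (d + 1) k
  haveI : IsProper X.hom := by rw [← Over.w i]; infer_instance
  haveI : CompactSpace ↥X.left := compactSpace_of_quasiCompact_hom X
  obtain ⟨a, Pl, hPl, hrat⟩ := exists_three_smul_primeCycle_sub_mem X i hd hF hprime hrange hdim ℓ hℓ hlin
    hav w hw hFw z hz
  refine ⟨a, (finite_support_of_compactSpace Pl).toFinset, fun y => Pl y, fun y hy => hPl y
    (Function.mem_support.mp ((Set.Finite.mem_toFinset _).mp hy)), ?_⟩
  change _ - (_ + ∑ y ∈ (finite_support_of_compactSpace Pl).toFinset, Pl y • primeCycle y) ∈ ratTrivial X.left 2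
  rw [← eq_sum_smul_primeCycle_of_support_subset Pl (s := (finite_support_of_compactSpace Pl).toFinset)
    (by rw [Set.Finite.coe_toFinset]), ← sub_sub]
  exact hrat

/-- **`3 · CH₂(X) ⊆ ℤ · (c₁(𝒪_X(1))^{d-2} ∩ [X]) + ⟨planes⟩`** — Mboro's Thm. 1.2 for cubic
hypersurfaces and surfaces as a statement on the Chow group `CH₂(X)` of an integral cubic hypersurface
`X = V₊(F) ⊆ ℙᵈ⁺¹_k` (`k` algebraically closed, `d ≥ 14`): three times every class lies in the
subgroup generated by the class `H_X^{d-2} ∩ [X]` (`ProjSpace.hyperplaneSectionOnIter`, for any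
hyperplane `V₊(ℓ₀) ⊅ X`) and the plane classes (`linearSubspaceClasses 2`). (`CH₂(X)` is generated
by the `[closure {z}]`, `dim z = 2`, and for those `three_smul_primeCycle_isRationallyEquivalent`.)
[cite: Mboro2018, Thm. 1.2 (arXiv:1701.04488, p. 6)] -/
theorem three_smul_mem_zmultiples_sup_closure_linearSubspaceClasses (hd : 14 ≤ d)
    (hF : F ∈ grading (Fin (d + 1 + 1)) k 3) (hprime : Prime F)
    (hrange : Set.range i.left.base =
      ProjectiveSpectrum.zeroLocus (homogeneousSubmodule (Fin (d + 1 + 1)) k) {F})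
    {c : ℕ} (hdim : 2 + c = d) {ℓ₀ : MvPolynomial (Fin (d + 1 + 1)) k}
    (hℓ₀ : ℓ₀ ∈ grading (Fin (d + 1 + 1)) k 1) (hℓ₀0 : ℓ₀ ≠ 0)
    (hX₀ : (formDivisor ℓ₀ hℓ₀ hℓ₀0).Avoids (i.left.base (genericPoint ↥X.left)))
    (γ : ChowGroup X.left 2) :
    3 • γ ∈ AddSubgroup.zmultiples (hyperplaneSectionOnIter i hℓ₀ hℓ₀0 hX₀ 2 c
        (ChowGroup.mk X.left (2 + c) ⟨primeCycle (genericPoint ↥X.left), primeCycle_mem_cyclesOfDim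
          (by rw [Hypersurface.height_genericPoint i hF hprime hrange]; exact_mod_cast hdim.symm)⟩)) ⊔
      AddSubgroup.closure (linearSubspaceClasses 2 (d + 1) i) := by
  classical
  haveI : IsProper (projectiveSpace (d + 1) k).hom := isProper_projectiveSpace (d + 1) k
  haveI : IsProper X.hom := by rw [← Over.w i]; infer_instance
  haveI : CompactSpace ↥X.left := compactSpace_of_quasiCompact_hom X
  have hF3 : F.IsHomogeneous 3 := (mem_homogeneousSubmodule 3 F).1 hF
  -- a `3`-plane `M = V₊(ℓ₁, …, ℓ_c) ⊄ X` whose hyperplanes do not contain `X`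
  obtain ⟨ℓ, hlin, hhom, hFℓ⟩ := exists_linearForms_not_mem_idealSpan (N := d + 1) three_pos hF3
    hprime.ne_zero (c := c) (by omega)
  have hℓ : ∀ j, ℓ j ∈ grading (Fin (d + 1 + 1)) k 1 :=
    fun j => (MvPolynomial.mem_homogeneousSubmodule 1 _).2 (hhom j)
  have hav : ∀ j, (formDivisor (ℓ j) (hℓ j) (hlin.ne_zero j)).Avoids
      (i.left.base (genericPoint ↥X.left)) := by
    intro j
    refine Hypersurface.formDivisor_avoids_base_genericPoint i hF hprime hrange (hℓ j) (hlin.ne_zero j) fun h => hFℓ ?_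
    exact Ideal.span_mono (Set.singleton_subset_iff.2 (Set.mem_range_self j)) h
  obtain ⟨w, hw, -, -⟩ := exists_point_of_linearIndependent ℓ hlin hhom (by omega)
  have hFw : F ∉ ProjectiveSpectrum.asHomogeneousIdeal
      (𝒜 := MvPolynomial.homogeneousSubmodule (Fin (d + 1 + 1)) k) w := by
    intro h
    apply hFℓ
    rw [← hw]
    exact h
  -- the subgroup of classes `γ` with `3 γ` in the target
  let G : AddSubgroup (ChowGroup X.left 2) :=
    AddSubgroup.zmultiples (hyperplaneSectionOnIter i hℓ₀ hℓ₀0 hX₀ 2 c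
        (ChowGroup.mk X.left (2 + c) ⟨primeCycle (genericPoint ↥X.left), primeCycle_mem_cyclesOfDim
          (by rw [Hypersurface.height_genericPoint i hF hprime hrange]; exact_mod_cast hdim.symm)⟩)) ⊔
      AddSubgroup.closure (linearSubspaceClasses 2 (d + 1) i)
  let H : AddSubgroup (ChowGroup X.left 2) := G.comap (nsmulAddMonoidHom 3)
  suffices hH : H = ⊤ by
    have hγ : γ ∈ H := by rw [hH]; exact AddSubgroup.mem_top γ
    exact hγ
  refine ChowGroup.eq_top_of_forall_ofPoint_mem fun z hz => ?_
  change 3 • ChowGroup.ofPoint z hz ∈ G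
  obtain ⟨a, s, wt, hs, hrat⟩ := three_smul_primeCycle_isRationallyEquivalent X i hd hF hprime hrange hdim
    ℓ hℓ hlin hav w hw hFw z hz
  -- in `CH₂(X)`
  have hdimX : primeCycle (genericPoint ↥X.left) ∈ cyclesOfDim X.left (2 + c) :=
    primeCycle_mem_cyclesOfDim (by rw [Hypersurface.height_genericPoint i hF hprime hrange]; exact_mod_cast hdim.symm)
  have hiter : CartierDivisor.iterInter c
      (fun j => (formDivisor (ℓ j) (hℓ j) (hlin.ne_zero j)).pullbackAvoiding i.left (hav j))
      (primeCycle (genericPoint ↥X.left)) ∈ cyclesOfDim X.left 2 :=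
    CartierDivisor.iterInter_mem_cyclesOfDim c _ hdimX
  have hsum : (∑ y ∈ s, wt y • primeCycle y) ∈ cyclesOfDim X.left 2 :=
    sum_zsmul_primeCycle_mem_cyclesOfDim_of_isLinearSubspacePoint wt hs
  have hmk : ChowGroup.mk X.left 2 ⟨3 • primeCycle z, AddSubgroup.nsmul_mem _ (primeCycle_mem_cyclesOfDim hz) 3⟩ =
      ChowGroup.mk X.left 2 ⟨a • CartierDivisor.iterInter c
          (fun j => (formDivisor (ℓ j) (hℓ j) (hlin.ne_zero j)).pullbackAvoiding i.left (hav j))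
          (primeCycle (genericPoint ↥X.left)) + ∑ y ∈ s, wt y • primeCycle y,
        AddSubgroup.add_mem _ (AddSubgroup.zsmul_mem _ hiter a) hsum⟩ :=
    ChowGroup.mk_eq_mk_iff.2 hrat
  have h3 : 3 • ChowGroup.ofPoint z hz =
      ChowGroup.mk X.left 2 ⟨3 • primeCycle z, AddSubgroup.nsmul_mem _ (primeCycle_mem_cyclesOfDim hz) 3⟩ := by
    rw [ChowGroup.ofPoint, ← map_nsmul]
    rfl
  have hsplit : ChowGroup.mk X.left 2 ⟨a • CartierDivisor.iterInter c
          (fun j => (formDivisor (ℓ j) (hℓ j) (hlin.ne_zero j)).pullbackAvoiding i.left (hav j))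
          (primeCycle (genericPoint ↥X.left)) + ∑ y ∈ s, wt y • primeCycle y,
        AddSubgroup.add_mem _ (AddSubgroup.zsmul_mem _ hiter a) hsum⟩ =
      a • ChowGroup.mk X.left 2 ⟨_, hiter⟩ + ChowGroup.mk X.left 2 ⟨_, hsum⟩ := by
    rw [← map_zsmul, ← map_add]
    rfl
  rw [h3, hmk, hsplit]
  refine AddSubgroup.add_mem _ (AddSubgroup.mem_sup_left (AddSubgroup.zsmul_mem _ ?_ a))
    (AddSubgroup.mem_sup_right ?_)
  · rw [Hypersurface.mk_iterInter_primeCycle_eq_hyperplaneSectionOnIter i hF hprime hrange hdim ℓ hℓ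
      (fun j => hlin.ne_zero j) hav hℓ₀ hℓ₀0 hX₀]
    exact AddSubgroup.mem_zmultiples _
  · -- a finite sum of plane classes
    have hγeq : (⟨∑ y ∈ s, wt y • primeCycle y, hsum⟩ : ↥(cyclesOfDim X.left 2)) =
        ∑ y ∈ s.attach, wt y • (⟨primeCycle (y : ↥X.left), (hs y y.2).primeCycle_mem⟩ : ↥(cyclesOfDim X.left 2)) := by
      apply Subtype.ext
      rw [AddSubgroup.val_finsetSum]
      simp only [AddSubgroup.coe_zsmul]
      exact (Finset.sum_attach s fun y => wt y • primeCycle y).symm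
    rw [hγeq, map_sum]
    refine AddSubgroup.sum_mem _ fun y _ => ?_
    rw [map_zsmul]
    refine AddSubgroup.zsmul_mem _ (AddSubgroup.subset_closure ?_) _
    exact ⟨(y : ↥X.left), hs y y.2, rfl⟩

end Main

end ProjFamily

end Literature.AlgebraicGeometry.Motives
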